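import Mathlib
import Summits.MatrixMultiplication.MatrixMultiplication.Theorems.GLnSeparatingDesignsExactHalfDimensionDesignsBorderOfExact
import Summits.MatrixMultiplication.MatrixMultiplication.Theorems.BorderHalfDimensionDesigns.Negative.FlagMinorHypersurfaceDesignsFalse

/-!
# Line `Sketch` (card `split-torus-borel-pair`) for crux `BorderHalfDimensionDesigns`
(stmt-MatrixMultiplication-18360, route `GLnSeparatingDesigns`) — lead's skeleton, FINAL STATE: LINE DEAD

Rebuilt from the card (the planner's `Sketch.lean` is not readable from the lead's seat).

* `C⁺ = FlagMinorHypersurfaceDesigns` = `stub_flagMinorHypersurfaceDesigns` below — the line's hardest stub.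
  **REFUTED**: `stub_flagMinorHypersurfaceDesigns_false : ¬ C⁺` is in the tree
  (`Theorems/BorderHalfDimensionDesigns/Negative/FlagMinorHypersurfaceDesignsFalse.lean`, p151035), composed from
  the landed helper stubs H1–H8 (p147681 p147680 p148946 p150479 p147672 p147718 p149640 p148818): a `Y`-test
  `R(Δ₁^q,…,Δₙ^q)` of degree `d ≤ q^δ` forces `|Y| ≤ (d+1)^n (qnd+1)^(n(n−1)/2) < q^(n²/2 − n/4)`.
* transfer `C⁺ → ExactHalfDimensionDesigns`: vacuous (`absurd`); glue `borderHalfDimensionDesigns_of_exact` (tree).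
* Hence the composition below closes the crux modulo ONE stub, and that stub is FALSE: the line is dead
  (see `Lines/Sketch.dead.md`); the crux is not refuted.
-/

set_option linter.dupNamespace false

open Summit.MatrixMultiplication.MatrixMultiplication.Theses.GLnSeparatingDesigns

namespace Summit.MatrixMultiplication.MatrixMultiplication.Theorems.BorderHalfDimensionDesigns

/-- STUB (hardest, the carded C⁺ `FlagMinorHypersurfaceDesigns`) — REFUTED by
`stub_flagMinorHypersurfaceDesigns_false`; kept sorried only to display the dead composition. -/
theorem stub_flagMinorHypersurfaceDesigns :
    ∀ ε : ℝ, 0 < ε → ∃ n : ℕ, 3 ≤ n ∧ ∀ δ : ℝ, 0 < δ → ∀ q₀ : ℕ, ∃ q : ℕ, q₀ ≤ q ∧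
      ∃ Y : Finset (Matrix.GeneralLinearGroup (Fin n) ℂ), ∃ R : MvPolynomial (Fin n) ℂ,
        (q : ℝ) ^ ((n : ℝ) ^ 2 / 2 - ε * n) ≤ (Y.card : ℝ) ∧
        (R.totalDegree : ℝ) ≤ (q : ℝ) ^ δ ∧
        MvPolynomial.eval (fun _ => (1 : ℂ)) R = 1 ∧
        ∀ y ∈ Y, ∀ y' ∈ Y, y ≠ y' →
          MvPolynomial.eval (fun j : Fin n =>
            (Literature.NumberTheory.Automorphic.leadMinor Fin.castSucc
              ((y⁻¹ * y' : Matrix.GeneralLinearGroup (Fin n) ℂ) : Matrix (Fin n) (Fin n) ℂ) j.succ) ^ q) R = 0 := by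
  sorry

/-- Transfer (vacuous, since `C⁺` is false). -/
theorem exactHalfDimensionDesigns_of_flagMinor
    (h : ∀ ε : ℝ, 0 < ε → ∃ n : ℕ, 3 ≤ n ∧ ∀ δ : ℝ, 0 < δ → ∀ q₀ : ℕ, ∃ q : ℕ, q₀ ≤ q ∧
      ∃ Y : Finset (Matrix.GeneralLinearGroup (Fin n) ℂ), ∃ R : MvPolynomial (Fin n) ℂ,
        (q : ℝ) ^ ((n : ℝ) ^ 2 / 2 - ε * n) ≤ (Y.card : ℝ) ∧
        (R.totalDegree : ℝ) ≤ (q : ℝ) ^ δ ∧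
        MvPolynomial.eval (fun _ => (1 : ℂ)) R = 1 ∧
        ∀ y ∈ Y, ∀ y' ∈ Y, y ≠ y' →
          MvPolynomial.eval (fun j : Fin n =>
            (Literature.NumberTheory.Automorphic.leadMinor Fin.castSucc
              ((y⁻¹ * y' : Matrix.GeneralLinearGroup (Fin n) ℂ) : Matrix (Fin n) (Fin n) ℂ) j.succ) ^ q) R = 0) :
    ExactHalfDimensionDesigns :=
  absurd h stub_flagMinorHypersurfaceDesigns_false

/-- COMPOSITION: the line closes the crux modulo its single (refuted) stub — i.e. it does not. -/
theorem BorderHalfDimensionDesigns_of : BorderHalfDimensionDesigns :=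
  borderHalfDimensionDesigns_of_exact (exactHalfDimensionDesigns_of_flagMinor stub_flagMinorHypersurfaceDesigns)

end Summit.MatrixMultiplication.MatrixMultiplication.Theorems.BorderHalfDimensionDesigns
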